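import Literature.Computability.Cryptography.ChenQuantumLWEWindowProfile
import Literature.NumberTheory.Sieve.CompletionOfSums

/-!
# Interval windows on Chen's chirped line: the Pólya–Vinogradov ceiling `(2 + log P)/√P` (T8 exact)

REPRODUCTION / ANALYSIS OF A CLAIMED RESULT UNDER ADJUDICATION (withdrawn): Yilei Chen, *Quantum
Algorithms for Lattice Problems*, IACR ePrint 2024/555, version of 2024-04-18 [ChenQuantumLattice2024]
(the version carrying the author's note that Step 9 contains a bug), Step 9 (§3.5.9, pp. 34–38) acting
on `|φ8.b⟩ = Σ_{j ∈ ℤ_P} e(-j²/P) |2D²j·b + v′ mod N⟩` (p. 35), `P = p₁Q`, `N = D²P`.  Bundle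
`papers/QuantumAdvantage/lwe-quantum-autopsy/`, Part 2 (`REPAIR-CENSUS.md` §1 theorem **T8** and §10),
sequel of `ChenQuantumLWEWindowProfile.lean` (T9: the hyperplane value `t = ⟨b, u mod P⟩` of one run
has probability `|ĉ(−2t)|²/(P‖c‖²)` for a line profile `c`; a chirp windowed to `S ⊂ ℤ_P` gives
`|G_S(t)|²/(P|S|) ≤ |S|/P`).
HONEST FRAMING: kernel-checked THEOREMS about states occurring in a WITHDRAWN algorithm — a
quantitative NEGATIVE result for the "window / smooth the chirp instead of cancelling it" repairs,
NOT summit progress, no cryptanalytic claim in either direction, no new algorithm; quantum lower bounds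
are out of scope.

## What is proved

For the chirp restricted to an INTERVAL window of `W ≤ P` consecutive line positions
(`intervalWindow A W = {A+1, …, A+W} mod P` — the best case of T8, in which the window's position in
the LINE coordinate `j` is granted; a window placed in register coordinates is this one translated by
the unknown centre, `ChenQuantumLWEChirpFourier.centreError`):

* `norm_dft_chirp`: every finite Fourier coefficient of `j ↦ ψ_P(−(j+t)²)` has modulus EXACTLY `√P`
  (odd `P`; a quadratic Gauss sum with unit leading coefficient,
  `Literature.NumberTheory.GaussSums.norm_sq_sum_stdAddChar_quadratic`).
* `norm_incGauss_interval_le`: hence, by COMPLETION OF SUMS (the tree's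
  `Literature.NumberTheory.Sieve.LargeSieve.norm_sum_Ioc_le_of_dft_le`, Bordellès Thm 6.13 /
  [Korobov1992, Ch. I §2 Thm 2]), the incomplete Gauss sum over any interval window satisfies
  `|G_S(t)| ≤ √P·W/P + √P(1 + log P) ≤ √P(2 + log P)` for every shift `t`.
* `prob_intervalWindow_le`: the probability of every hyperplane value is `≤ (2 + log P)²/W`;
  with T9's `≤ W/P` (`prob_windowedChirp_le`), **`prob_intervalWindow_le_sqrt`**: for EVERY width
  `1 ≤ W ≤ P`, EVERY position `A`, EVERY value `t`, every `b` with `b₀ = −1` and every offset `v′`,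
  `Pr[⟨b, u mod P⟩ = t] ≤ (2 + log P)/√P` — the law of one run never concentrates: a window narrow
  enough to localise the chirp's instantaneous frequency is too narrow to resolve it (T8's
  "error `≳ √P` at best", now a theorem with an explicit constant).
* `Shape.prob_intervalWindow_le_sqrt`: the same for every admissible shape (`P = p₁Q ≥ 9`).

## What is NOT here

Non-interval windows (T9's `≤ |S|/P` is all that holds in general; a window adapted to the chirp's
phase pattern would need the chirp centre, `REPAIR-CENSUS.md` §10); the `log` is not optimised
(Korobov's form has `1 + log P`); nothing about how a modified Steps 1–8 would produce such a window.
-/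

namespace Literature.Computability.Cryptography.Chen2024

open scoped BigOperators

section IntervalWindow

variable (p₁ Q : ℕ+)

/-- The INTERVAL WINDOW `{A+1, …, A+W} ⊂ ℤ_P` of line positions (reduced mod `P`). [folklore] -/
def intervalWindow (A W : ℕ) : Finset (ZP p₁ Q) :=
  (Finset.Ioc A (A + W)).image fun m : ℕ => (m : ZP p₁ Q)

/-- Reduction mod `P` is injective on `W ≤ P` consecutive integers. [folklore] -/
theorem natCast_injOn_Ioc (A W : ℕ) (hW : W ≤ ((p₁ * Q : ℕ+) : ℕ)) :
    Set.InjOn (fun m : ℕ => (m : ZP p₁ Q)) (Finset.Ioc A (A + W) : Set ℕ) := by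
  intro m₁ h₁ m₂ h₂ h
  rw [Finset.coe_Ioc, Set.mem_Ioc] at h₁ h₂
  have hd : (((p₁ * Q : ℕ+) : ℕ) : ℤ) ∣ (m₂ : ℤ) - m₁ :=
    Nat.modEq_iff_dvd.1 ((ZMod.natCast_eq_natCast_iff _ _ _).1 h)
  have habs : |(m₂ : ℤ) - m₁| < (((p₁ * Q : ℕ+) : ℕ) : ℤ) := by
    rw [abs_sub_lt_iff]
    constructor <;> omega
  have h0 := Int.eq_zero_of_abs_lt_dvd hd habs
  omega

/-- An interval window of width `W ≤ P` has exactly `W` points. [folklore] -/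
theorem card_intervalWindow (A W : ℕ) (hW : W ≤ ((p₁ * Q : ℕ+) : ℕ)) :
    (intervalWindow p₁ Q A W).card = W := by
  rw [intervalWindow, Finset.card_image_of_injOn (natCast_injOn_Ioc p₁ Q A W hW), Nat.card_Ioc,
    add_tsub_cancel_left]

/-- An interval window of positive width is non-empty. [folklore] -/
theorem intervalWindow_nonempty (A W : ℕ) (hW0 : 0 < W) : (intervalWindow p₁ Q A W).Nonempty :=
  Finset.image_nonempty.2 ⟨A + 1, Finset.mem_Ioc.2 ⟨Nat.lt_succ_self A, by omega⟩⟩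

/-- The incomplete Gauss sum over an interval window, written over the integers of the interval.
[folklore] -/
theorem incGauss_intervalWindow (A W : ℕ) (hW : W ≤ ((p₁ * Q : ℕ+) : ℕ)) (t : ZP p₁ Q) :
    incGauss p₁ Q (intervalWindow p₁ Q A W) t
      = ∑ m ∈ Finset.Ioc A (A + W), (ZMod.stdAddChar (-(((m : ℕ) : ZP p₁ Q) + t) ^ 2) : ℂ) := by
  rw [incGauss, intervalWindow, Finset.sum_image (natCast_injOn_Ioc p₁ Q A W hW)]

/-- **Every Fourier coefficient of the shifted chirp has modulus `√P`** (odd `P`): `|𝓕(ψ_P(−(·+t)²))(k)| = √P`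
for ALL `k` — Mathlib's `ZMod.dft`; a quadratic Gauss sum with unit leading coefficient.
[cite: Korobov1992, Ch. I §3 Thm 3] -/
theorem norm_dft_chirp (hP : Odd ((p₁ * Q : ℕ+) : ℕ)) (t k : ZP p₁ Q) :
    ‖ZMod.dft (fun j : ZP p₁ Q => (ZMod.stdAddChar (-((j + t) ^ 2)) : ℂ)) k‖
      = Real.sqrt ((p₁ * Q : ℕ+) : ℕ) := by
  rw [ZMod.dft_apply]
  simp_rw [smul_eq_mul]
  have h : ∑ j : ZP p₁ Q, (ZMod.stdAddChar (-(j * k)) : ℂ) * ZMod.stdAddChar (-((j + t) ^ 2))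
      = ZMod.stdAddChar (-(t ^ 2))
        * ∑ j : ZP p₁ Q, ZMod.stdAddChar ((-1) * j ^ 2 + (-(2 * t) - k) * j) := by
    rw [Finset.mul_sum]
    refine Finset.sum_congr rfl fun j _ => ?_
    rw [← AddChar.map_add_eq_mul, ← AddChar.map_add_eq_mul]
    congr 1
    ring
  rw [h, norm_mul, ZMod.stdAddChar_apply, Circle.norm_coe, one_mul,
    ← Real.sqrt_sq (norm_nonneg _),
    Literature.NumberTheory.GaussSums.norm_sq_sum_stdAddChar_quadratic _ hP (-1) _ isUnit_one.neg]

/-- The complete sum (`k = 0`): `|Σ_j ψ_P(−(j+t)²)| = √P`. [cite: Korobov1992, Ch. I §3 Thm 3] -/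
theorem norm_sum_chirp (hP : Odd ((p₁ * Q : ℕ+) : ℕ)) (t : ZP p₁ Q) :
    ‖∑ j : ZP p₁ Q, (ZMod.stdAddChar (-((j + t) ^ 2)) : ℂ)‖ = Real.sqrt ((p₁ * Q : ℕ+) : ℕ) := by
  rw [← Real.sqrt_sq (norm_nonneg _)]
  congr 1
  exact norm_sq_incGauss_univ p₁ Q hP t

/-- **Pólya–Vinogradov for the windowed chirp** (completion of sums): for odd `P ≥ 2`, every interval
window of width `W ≤ P` and every shift `t`,
`|G_S(t)| ≤ √P·(W/P) + √P·(1 + log P)`. [cite: Korobov1992, Ch. I §2 Thm 2 and §3 Thm 3; Bordelles2020ArithmeticTales, Thm 6.13] -/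
theorem norm_incGauss_interval_le' (hP : Odd ((p₁ * Q : ℕ+) : ℕ)) (h2 : 2 ≤ ((p₁ * Q : ℕ+) : ℕ))
    (A W : ℕ) (hW : W ≤ ((p₁ * Q : ℕ+) : ℕ)) (t : ZP p₁ Q) :
    ‖incGauss p₁ Q (intervalWindow p₁ Q A W) t‖
      ≤ Real.sqrt ((p₁ * Q : ℕ+) : ℕ) * ((W : ℝ) / ((p₁ * Q : ℕ+) : ℕ))
        + Real.sqrt ((p₁ * Q : ℕ+) : ℕ) * (1 + Real.log ((p₁ * Q : ℕ+) : ℕ)) := by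
  rw [incGauss_intervalWindow p₁ Q A W hW]
  exact Literature.NumberTheory.Sieve.LargeSieve.norm_sum_Ioc_le_of_dft_le h2
    (fun j : ZP p₁ Q => (ZMod.stdAddChar (-((j + t) ^ 2)) : ℂ)) (norm_sum_chirp p₁ Q hP t).le
    (fun k _ => (norm_dft_chirp p₁ Q hP t k).le) A W

/-- **Pólya–Vinogradov for the windowed chirp**, clean form: `|G_S(t)| ≤ √P·(2 + log P)` for every
interval window of width `W ≤ P` and every shift. [cite: Korobov1992, Ch. I §2 Thm 2 and §3 Thm 3] -/
theorem norm_incGauss_interval_le (hP : Odd ((p₁ * Q : ℕ+) : ℕ)) (h2 : 2 ≤ ((p₁ * Q : ℕ+) : ℕ))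
    (A W : ℕ) (hW : W ≤ ((p₁ * Q : ℕ+) : ℕ)) (t : ZP p₁ Q) :
    ‖incGauss p₁ Q (intervalWindow p₁ Q A W) t‖
      ≤ Real.sqrt ((p₁ * Q : ℕ+) : ℕ) * (2 + Real.log ((p₁ * Q : ℕ+) : ℕ)) := by
  have hP0 : (0 : ℝ) < (((p₁ * Q : ℕ+) : ℕ) : ℝ) := by exact_mod_cast PNat.pos _
  have hWP : (W : ℝ) / ((p₁ * Q : ℕ+) : ℕ) ≤ 1 := (div_le_one hP0).2 (by exact_mod_cast hW)
  calc ‖incGauss p₁ Q (intervalWindow p₁ Q A W) t‖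
      ≤ Real.sqrt ((p₁ * Q : ℕ+) : ℕ) * ((W : ℝ) / ((p₁ * Q : ℕ+) : ℕ))
          + Real.sqrt ((p₁ * Q : ℕ+) : ℕ) * (1 + Real.log ((p₁ * Q : ℕ+) : ℕ)) :=
        norm_incGauss_interval_le' p₁ Q hP h2 A W hW t
    _ ≤ Real.sqrt ((p₁ * Q : ℕ+) : ℕ) * 1
          + Real.sqrt ((p₁ * Q : ℕ+) : ℕ) * (1 + Real.log ((p₁ * Q : ℕ+) : ℕ)) := by gcongr
    _ = Real.sqrt ((p₁ * Q : ℕ+) : ℕ) * (2 + Real.log ((p₁ * Q : ℕ+) : ℕ)) := by ring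

end IntervalWindow

section Line

variable (n : ℕ) (D p₁ Q : ℕ+) (b v' : Fin (n + 1) → ℤ)

/-- **Interval window, first bound**: every hyperplane value `t` has probability `≤ (2 + log P)²/W`.
[cite: Korobov1992, Ch. I §2 Thm 2 and §3 Thm 3; ChenQuantumLattice2024, §3.5.9 pp. 35–38] -/
theorem prob_intervalWindow_le (hP : Odd ((p₁ * Q : ℕ+) : ℕ)) (h2 : 2 ≤ ((p₁ * Q : ℕ+) : ℕ))
    (hb : b 0 = -1) (A W : ℕ) (hW0 : 0 < W) (hW : W ≤ ((p₁ * Q : ℕ+) : ℕ)) (t : ZP p₁ Q) :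
    (∑ u ∈ Finset.univ.filter (fun u : Fin (n + 1) → ZN D p₁ Q => lineFun n D p₁ Q b u = t),
        weight (qft (profileKet n D p₁ Q b v' (windowedChirp p₁ Q (intervalWindow p₁ Q A W)))) u)
        / ∑ u, weight (qft (profileKet n D p₁ Q b v' (windowedChirp p₁ Q (intervalWindow p₁ Q A W)))) u
      ≤ (2 + Real.log ((p₁ * Q : ℕ+) : ℕ)) ^ 2 / W := by
  have hP0 : (0 : ℝ) < (((p₁ * Q : ℕ+) : ℕ) : ℝ) := by exact_mod_cast PNat.pos _
  have hW0' : (0 : ℝ) < (W : ℝ) := by exact_mod_cast hW0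
  rw [prob_windowedChirp_eq n D p₁ Q b v' hP hb _ (intervalWindow_nonempty p₁ Q A W hW0) t,
    card_intervalWindow p₁ Q A W hW]
  have hG := norm_incGauss_interval_le p₁ Q hP h2 A W hW t
  calc ‖incGauss p₁ Q (intervalWindow p₁ Q A W) t‖ ^ 2 / ((((p₁ * Q : ℕ+) : ℕ) : ℝ) * W)
      ≤ (Real.sqrt ((p₁ * Q : ℕ+) : ℕ) * (2 + Real.log ((p₁ * Q : ℕ+) : ℕ))) ^ 2
          / ((((p₁ * Q : ℕ+) : ℕ) : ℝ) * W) := by gcongr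
    _ = (2 + Real.log ((p₁ * Q : ℕ+) : ℕ)) ^ 2 / W := by
        rw [mul_pow, Real.sq_sqrt hP0.le]
        field_simp

/-- **T8 exact — interval windows never concentrate the law.** For odd `P ≥ 2`, `b₀ = −1`, EVERY
interval window of width `1 ≤ W ≤ P` at EVERY position, EVERY hyperplane value `t` and every offset
`v′`: `Pr[⟨b, u mod P⟩ = t] ≤ (2 + log P)/√P` (geometric mean of `≤ W/P` and `≤ (2 + log P)²/W`).
[cite: Korobov1992, Ch. I §2 Thm 2 and §3 Thm 3; ChenQuantumLattice2024, §3.5.9 pp. 35–38, §3.7.1 p. 60] -/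
theorem prob_intervalWindow_le_sqrt (hP : Odd ((p₁ * Q : ℕ+) : ℕ)) (h2 : 2 ≤ ((p₁ * Q : ℕ+) : ℕ))
    (hb : b 0 = -1) (A W : ℕ) (hW0 : 0 < W) (hW : W ≤ ((p₁ * Q : ℕ+) : ℕ)) (t : ZP p₁ Q) :
    (∑ u ∈ Finset.univ.filter (fun u : Fin (n + 1) → ZN D p₁ Q => lineFun n D p₁ Q b u = t),
        weight (qft (profileKet n D p₁ Q b v' (windowedChirp p₁ Q (intervalWindow p₁ Q A W)))) u)
        / ∑ u, weight (qft (profileKet n D p₁ Q b v' (windowedChirp p₁ Q (intervalWindow p₁ Q A W)))) u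
      ≤ (2 + Real.log ((p₁ * Q : ℕ+) : ℕ)) / Real.sqrt ((p₁ * Q : ℕ+) : ℕ) := by
  have hP0 : (0 : ℝ) < (((p₁ * Q : ℕ+) : ℕ) : ℝ) := by exact_mod_cast PNat.pos _
  have hW0' : (0 : ℝ) < (W : ℝ) := by exact_mod_cast hW0
  have hL : 0 ≤ 2 + Real.log ((p₁ * Q : ℕ+) : ℕ) := by
    have : 0 ≤ Real.log ((p₁ * Q : ℕ+) : ℕ) :=
      Real.log_nonneg (by exact_mod_cast (le_trans (by norm_num) h2 : 1 ≤ ((p₁ * Q : ℕ+) : ℕ)))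
    linarith
  -- the two bounds of an abstract probability `Pr` combine to their geometric mean
  have key : ∀ Pr : ℝ, Pr ≤ (W : ℝ) / ((p₁ * Q : ℕ+) : ℕ)
      → Pr ≤ (2 + Real.log ((p₁ * Q : ℕ+) : ℕ)) ^ 2 / W → 0 ≤ Pr
      → Pr ≤ (2 + Real.log ((p₁ * Q : ℕ+) : ℕ)) / Real.sqrt ((p₁ * Q : ℕ+) : ℕ) := by
    intro Pr hA hB h0
    have hsq : Pr ^ 2 ≤ ((2 + Real.log ((p₁ * Q : ℕ+) : ℕ)) / Real.sqrt ((p₁ * Q : ℕ+) : ℕ)) ^ 2 := by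
      calc Pr ^ 2 = Pr * Pr := sq Pr
        _ ≤ ((W : ℝ) / ((p₁ * Q : ℕ+) : ℕ)) * ((2 + Real.log ((p₁ * Q : ℕ+) : ℕ)) ^ 2 / W) :=
            mul_le_mul hA hB h0 (by positivity)
        _ = ((2 + Real.log ((p₁ * Q : ℕ+) : ℕ)) / Real.sqrt ((p₁ * Q : ℕ+) : ℕ)) ^ 2 := by
            rw [div_pow, Real.sq_sqrt hP0.le]
            field_simp
    have h := Real.sqrt_le_sqrt hsq
    rwa [Real.sqrt_sq h0, Real.sqrt_sq (div_nonneg hL (Real.sqrt_nonneg _))] at h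
  have hA := prob_windowedChirp_le n D p₁ Q b v' hP hb _ (intervalWindow_nonempty p₁ Q A W hW0) t
  rw [card_intervalWindow p₁ Q A W hW] at hA
  exact key _ hA (prob_intervalWindow_le n D p₁ Q b v' hP h2 hb A W hW0 hW t)
    (div_nonneg (Finset.sum_nonneg fun u _ => by unfold weight; positivity)
      (Finset.sum_nonneg fun u _ => by unfold weight; positivity))

end Line

end Literature.Computability.Cryptography.Chen2024

namespace Literature.Computability.Cryptography.Chen2024.Shape

open scoped BigOperators

variable (S : Shape)

/-- `P = p₁Q ≥ 9 ≥ 2` for an admissible shape. [cite: ChenQuantumLattice2024, Cond. C.3 p. 18] -/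
theorem Admissible.two_le_P {S : Shape} (h : S.Admissible) : 2 ≤ ((S.p₁ * S.Q : ℕ+) : ℕ) := by
  rw [PNat.mul_coe]
  calc 2 ≤ 3 * 3 := by norm_num
    _ ≤ (S.p₁ : ℕ) * (S.Q : ℕ) := Nat.mul_le_mul h.three_le_p₁ h.three_le_Q

/-- **T8 exact for every admissible shape**: with the chirp of `|φ8.b⟩` windowed to ANY interval of
`1 ≤ W ≤ P` line positions, every hyperplane value `⟨b, u mod P⟩ = t` of one run has probability
`≤ (2 + log P)/√P`. [cite: Korobov1992, Ch. I §2 Thm 2 and §3 Thm 3; ChenQuantumLattice2024, §3.5.9 pp. 35–38] -/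
theorem prob_intervalWindow_le_sqrt (h : S.Admissible) (A W : ℕ) (hW0 : 0 < W) (hW : W ≤ (S.P : ℕ))
    (t : ZP S.p₁ S.Q) :
    (∑ u ∈ Finset.univ.filter (fun u : Fin (S.n + 1) → ZMod S.N => lineFun S.n S.D S.p₁ S.Q S.b u = t),
        weight (qft (profileKet S.n S.D S.p₁ S.Q S.b S.v'
          (windowedChirp S.p₁ S.Q (intervalWindow S.p₁ S.Q A W)))) u)
        / ∑ u, weight (qft (profileKet S.n S.D S.p₁ S.Q S.b S.v'
          (windowedChirp S.p₁ S.Q (intervalWindow S.p₁ S.Q A W)))) u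
      ≤ (2 + Real.log (S.P : ℕ)) / Real.sqrt (S.P : ℕ) :=
  Chen2024.prob_intervalWindow_le_sqrt S.n S.D S.p₁ S.Q S.b S.v' h.odd_P h.two_le_P h.b_head A W hW0 hW t

end Literature.Computability.Cryptography.Chen2024.Shape
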